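import Mathlib

/-!
# Converse arithmetic of the word-length lower bound (`stub_converseArith`)

In the direction crux ⇒ pattern-chain hardness, a chain of length `m` yields a word of length
at most `c · m`, so the crux gives `n^(4+ε) ≤ c · m`, while the chain-hardness statement needs
`n · n · n^(2+ε/2) < m`.  This file proves that real-arithmetic step: for every `ε > 0` and every
natural constant `c` there is a threshold `n₁` beyond which `n^(4+ε) ≤ c · m` forces
`n · n · n^(2+ε/2) < m`.

Proof: `n^(4+ε) = n · n · n^(2+ε/2) · n^(ε/2)` for `n > 0`, and `n^(ε/2) > c` as soon as
`n > c^(2/ε)`; hence `c · (n · n · n^(2+ε/2)) < n^(4+ε) ≤ c · m`, and we cancel `c ≥ 0`.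
-/

set_option linter.dupNamespace false

namespace Summit.ValiantsHypothesis.ValiantsHypothesis.Theorems.WordPerSuperQuartic

/-- If `c ^ (2/ε) < n` (as reals, with `0 < ε`), then `c < n ^ (ε/2)`. -/
private theorem converseArith_lt_rpow_half (ε : ℝ) (hε : 0 < ε) (c n : ℝ) (hc : 0 ≤ c)
    (hn : c ^ (2 / ε) < n) : c < n ^ (ε / 2) := by
  have hε2 : 0 < ε / 2 := by positivity
  have hεne : ε ≠ 0 := hε.ne'
  have h := Real.rpow_lt_rpow (Real.rpow_nonneg hc _) hn hε2
  rwa [← Real.rpow_mul hc, show (2 / ε) * (ε / 2) = (1 : ℝ) by field_simp, Real.rpow_one] at h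

/-- Splitting of the exponent: `n^(4+ε) = n · n · n^(2+ε/2) · n^(ε/2)` for `0 < n`. -/
private theorem converseArith_rpow_split (ε n : ℝ) (hn : 0 < n) :
    n ^ (4 + ε) = n * n * n ^ (2 + ε / 2) * n ^ (ε / 2) := by
  rw [show (4 + ε : ℝ) = 2 + (2 + ε / 2) + ε / 2 by ring, Real.rpow_add hn, Real.rpow_add hn,
    Real.rpow_two]
  ring

/-- **Converse arithmetic.**  For `0 < ε` and a natural constant `c`, there is `n₁` such that for
all `n ≥ n₁` and all `m`, `n^(4+ε) ≤ c · m` implies `n · n · n^(2+ε/2) < m`. -/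
theorem stub_converseArith (ε : ℝ) (hε : 0 < ε) (c : ℕ) :
    ∃ n₁ : ℕ, ∀ n ≥ n₁, ∀ m : ℕ, (n : ℝ) ^ (4 + ε) ≤ (c : ℝ) * m →
      (n : ℝ) * (n : ℝ) * (n : ℝ) ^ (2 + ε / 2) < (m : ℝ) := by
  refine ⟨⌈(c : ℝ) ^ (2 / ε)⌉₊ + 1, fun n hn m hm => ?_⟩
  have hc0 : (0 : ℝ) ≤ (c : ℝ) := Nat.cast_nonneg c
  -- `n` exceeds `c ^ (2/ε)`.
  have hnR : (c : ℝ) ^ (2 / ε) < (n : ℝ) := by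
    have h1 : (c : ℝ) ^ (2 / ε) ≤ (⌈(c : ℝ) ^ (2 / ε)⌉₊ : ℝ) := Nat.le_ceil _
    have h2 : ((⌈(c : ℝ) ^ (2 / ε)⌉₊ + 1 : ℕ) : ℝ) ≤ (n : ℝ) := by exact_mod_cast hn
    push_cast at h2
    linarith
  have hnpos : (0 : ℝ) < (n : ℝ) := lt_of_le_of_lt (Real.rpow_nonneg hc0 _) hnR
  -- Hence `c < n ^ (ε/2)`.
  have hkey : (c : ℝ) < (n : ℝ) ^ (ε / 2) := converseArith_lt_rpow_half ε hε c n hc0 hnR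
  have hApos : (0 : ℝ) < (n : ℝ) * (n : ℝ) * (n : ℝ) ^ (2 + ε / 2) := by positivity
  have hlt : (c : ℝ) * ((n : ℝ) * (n : ℝ) * (n : ℝ) ^ (2 + ε / 2)) < (c : ℝ) * (m : ℝ) :=
    calc (c : ℝ) * ((n : ℝ) * (n : ℝ) * (n : ℝ) ^ (2 + ε / 2))
        < (n : ℝ) ^ (ε / 2) * ((n : ℝ) * (n : ℝ) * (n : ℝ) ^ (2 + ε / 2)) :=
          mul_lt_mul_of_pos_right hkey hApos
      _ = (n : ℝ) ^ (4 + ε) := by rw [converseArith_rpow_split ε n hnpos]; ring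
      _ ≤ (c : ℝ) * (m : ℝ) := hm
  exact lt_of_mul_lt_mul_left hlt hc0

end Summit.ValiantsHypothesis.ValiantsHypothesis.Theorems.WordPerSuperQuartic
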